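import Literature.AnabelianGeometry.EtaleTheta.ArithThetaTowerConstTower
import Literature.AlgebraicGeometry.Frobenioids.PadicValuativeEndomorphisms
import HarnessLib

/-!
# [EtTh] Def. 3.3 (iii) / Prop. 3.4 (ii) constants for the ARITHMETIC theta tower, part 2 (INHABITANT):
# `Gal(K̄_v/K_v)` acts by isometries, `v` is restriction-invariant, and THE genuine constant tower
# `ConstTower.ofGaloisValDatum d : U ↦ ((Ω^U)^×, v)`

S. Mochizuki, *The étale theta function …*, Publ. RIMS **45** (2009) [MochizukiEtTh2009]: Def. 3.3 (iii) p.299 (PDF p.73),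
Prop. 3.4 (ii) p.300 (PDF p.74) («`O_L^× ≅ Ker(B₀ → Φ₀^gp)`, `L^× ≅ F₀(Y^log)`»), §5 p.330 (PDF p.104); S. Mochizuki, *The
geometry of Frobenioids II* (2008) [MochizukiFrdII2008], Ex. 1.1 (i) p.7 («`Spec(K) ↦ K^×` … `B₀`»), proof of Thm. 1.2 (i) p.9
(endomorphisms of the base act trivially on `ord`) [cite: MochizukiEtTh2009, Def 3.3 (iii) p.299 (PDF p.73)].

abc-iut cell, GAP A (G-L5-EX32I-1) item GA-01 = row D1 of GAP-SIZING-A (sha16 69de97346848d3e8), file 2 of 2 (the inhabitant;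
file 1 = `ArithThetaTowerConstTower.lean`, the TYPE `ConstTower d`); chair rulings abc-iut-L5-lead RULINGS #317 (2) / #319 /
#322 (c2′) «constants/valuations genuine at EVERY `U` via `T.proj`/`fieldFunctor`/`fixedFld`/`fixedHom` (this alone carries
sub-gap (a) non-vacuously)».  Consumed BY NAME: abc-iut-L5-t2's `GaloisValDatum` with `fieldFunctor`/`fixedFld`/`fixedHom`/
`valOn`/`fieldObj_isPadicLocal` (`GaloisCosetFields.lean`), abc-iut-L1-t4's `PadicFrd.bZeroOn` (`Spec K ↦ K^×` restricted along a
base functor, `PadicFrobenioid.lean`) and `PadicFrd.exists_pow_valuation_eq_zpow` (`PadicValuativeEndomorphisms.lean`), Mathlib's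
infinite Galois theory.

WHAT THIS FILE PROVES / CONSTRUCTS (every `d : GaloisValDatum p`):
* §1 `GaloisValDatum.exists_valuation_pow_eq_zpow` — for `x ∈ Ω^×` some `v(x)^n` (`n ≥ 1`) is an integral power of `v(p)`
  (`x` lies in the `p`-adic local field `Ω^U`, `U` the open fixing subgroup of `k(x)`; L1's finite-index lemma there, transported
  to `Ω` along `valOn`); hence **`GaloisValDatum.valuation_gal_eq : v(σ x) = v(x)`** for every `σ ∈ Gal(Ω/K_v)` — the Galois
  group acts on `Ω = K̄_v` by ISOMETRIES (abc-iut-L5-t2 booked this as «NOT DONE HERE … only `≤ 1` iff is needed», now proved);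
* §2 for ANY constant tower `K : ConstTower d`: **`v_map`** — the valuation is invariant under every restriction map (they read as
  Galois translates), so `integers`/`intUnits` are preserved and reflected; `exists_toΩ_eq_algebraMap` (the base-field constants
  `K_v^×` live at every level), `exists_toΩ_top_eq_iff` (the constants of the one-point covering `G/G` are EXACTLY `K_v^×`);
  **`equivOf K K'`** — any two constant towers are canonically, reading-compatibly and naturally isomorphic level by level (the
  TYPE pins the object: a binder `(K : ConstTower d)` assumes no mathematics);
* §3 **`ConstTower.ofGaloisValDatum d`** — THE genuine tower: `units := PadicFrd.bZeroOn d.fieldFunctor` BY NAME (the `B₀|_{D⊢_v}`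
  of [FrdII] Ex. 1.1 over the base functor `Spec Ω^U ↦ Ω^U` of the REAL `C_v`/`C⊢_v`, so that GAP A's sub-gap (a) functor
  `CdashToC` meets the SAME unit groups), `toΩ U := Units.map (Ω^U ⊆ Ω)`; by `rfl`: the level-`U` constants ARE `(Ω^U)^× =
  (d.fixedFld U)ˣ` and the restriction maps ARE `Units.map (d.fixedHom f)`; `v` there is the valuation `valOn` the genuine
  Frobenioids use (`v_le_one_iff_valOn`, `v_eq_one_iff_valOn`); the base constants `const U : K_v^× → (Ω^U)^×` (natural, read as
  `algebraMap K_v Ω`, with `O^▷_{K_v}`/`O^×_{K_v}` going to `integers`/`intUnits` — the source of [IUTchI] Ex. 3.2 (ii)'s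
  `O^×_{K_v} → O^×(T^÷_{Ÿ_v})`); NON-VACUITY `nonempty_ofPadic` at L5-t2's hypothesis-free datum `GaloisValDatum.ofPadic p`.
HONEST LABEL: classical Galois/valuation theory over Mathlib and landed tree interfaces; an UNDISPUTED construction around
[IUTchIII] Cor. 3.12 — nothing here bears on Cor. 3.12, no side taken (D-0045), nothing asserts the abc conjecture; no instance, no
notation, no `Prop`-valued definition, no sorry; typed ≠ proved elsewhere ≠ tokened.
-/

noncomputable section

namespace Literature.AnabelianGeometry.EtaleTheta

open CategoryTheory Opposite Literature.AnabelianGeometry.SemiGraphs Literature.IUT.HodgeTheaters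
  Literature.AlgebraicGeometry.Frobenioids

universe u v

/-! ## §1 `Gal(Ω/K_v)` acts on `Ω` by isometries -/

section Isometry

variable {p : ℕ} [Fact p.Prime] (d : GaloisValDatum.{u} p)

/-- The open subgroup `Gal(Ω/k(x))` of `Gal(Ω/k)` fixing the finite subextension `k(x)` (Krull topology), as an object
`Spec k(x)` of `D⊢_v = CosetCat Gal(Ω/K_v)`. [cite: MochizukiFrdII2008, Ex 1.1 (i) p.7] -/
def _root_.Literature.IUT.HodgeTheaters.GaloisValDatum.adjoinObj (x : d.Ω) : CosetCat d.Gal :=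
  haveI : FiniteDimensional d.k (IntermediateField.adjoin d.k ({x} : Set d.Ω)) :=
    IntermediateField.adjoin.finiteDimensional (Algebra.IsSeparable.isIntegral (F := d.k) x)
  ⟨⟨(IntermediateField.adjoin d.k ({x} : Set d.Ω)).fixingSubgroup,
    IntermediateField.fixingSubgroup_isOpen (IntermediateField.adjoin d.k ({x} : Set d.Ω))⟩⟩

/-- `x ∈ Ω^{Gal(Ω/k(x))}` (`= k(x)` by infinite Galois theory). [cite: MochizukiFrdII2008, Ex 1.1 (i) p.7] -/
theorem _root_.Literature.IUT.HodgeTheaters.GaloisValDatum.mem_fixedFld_adjoinObj (x : d.Ω) : x ∈ d.fixedFld (d.adjoinObj x) := by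
  change x ∈ IntermediateField.fixedField (IntermediateField.adjoin d.k ({x} : Set d.Ω)).fixingSubgroup
  rw [InfiniteGalois.fixedField_fixingSubgroup]
  exact IntermediateField.mem_adjoin_simple_self d.k x

/-- **Finite index of the value group, in `Ω`**: for `x ∈ Ω^×` there are `n ≥ 1`, `k ∈ ℤ` with `v(x)^n = v(p)^k` — `x` lies in
the `p`-adic local field `Ω^U` (`U = Gal(Ω/k(x))` open; `fieldObj_isPadicLocal`), where this is L1's
`PadicFrd.exists_pow_valuation_eq_zpow`, and the valuation of `Ω^U` is the restriction `valOn` of that of `Ω`.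
[cite: MochizukiFrdII2008, Thm 1.2 (i) p.9] -/
theorem _root_.Literature.IUT.HodgeTheaters.GaloisValDatum.exists_valuation_pow_eq_zpow {x : d.Ω} (hx : x ≠ 0) :
    ∃ n : ℕ, 0 < n ∧ ∃ k : ℤ,
      ValuativeRel.valuation d.Ω x ^ n = ValuativeRel.valuation d.Ω ((p : ℕ) : d.Ω) ^ k := by
  set X := d.adjoinObj x with hX
  set E := d.fixedFld X with hE
  letI := d.valOn E
  obtain ⟨⟨inst, hfin, hcomp⟩⟩ := d.fieldObj_isPadicLocal X
  letI : Algebra ℚ_[p] E := inst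
  haveI : Module.Finite ℚ_[p] E := hfin
  have hy0 : (⟨x, d.mem_fixedFld_adjoinObj x⟩ : E) ≠ 0 := fun h => hx (congrArg Subtype.val h)
  obtain ⟨n, hn, k, hk⟩ := PadicFrd.exists_pow_valuation_eq_zpow hcomp hy0
  refine ⟨n, hn, k, ?_⟩
  -- transport the equality of valuations in `E = Ω^U` (restricted relation) to `Ω`
  have h1 : (((⟨x, d.mem_fixedFld_adjoinObj x⟩ : E) ^ n : E) : d.Ω) = x ^ n := by
    rw [← IntermediateField.algebraMap_apply, map_pow, IntermediateField.algebraMap_apply]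
  have h2 : ((((p : ℕ) : E) ^ k : E) : d.Ω) = ((p : ℕ) : d.Ω) ^ k := by
    rw [← IntermediateField.algebraMap_apply, map_zpow₀, map_natCast]
  rw [← map_pow, ← map_zpow₀, ← Valuation.veq_iff_eq, ValuativeRel.veq_def] at hk
  rw [← map_pow, ← map_zpow₀, ← Valuation.veq_iff_eq, ValuativeRel.veq_def]
  have hk1 := (d.valOn_iff E _ _).mp hk.1
  have hk2 := (d.valOn_iff E _ _).mp hk.2
  refine ⟨?_, ?_⟩
  · rw [← h1, ← h2]
    exact hk1
  · rw [← h1, ← h2]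
    exact hk2

/-- **`Gal(Ω/K_v)` acts on `Ω = K̄_v` by isometries: `v(σ x) = v(x)`** — from `val_aut` (`σ` preserves `≤ᵥ`): `x^n` and `p^k` have
the same valuation, hence so do `σ(x)^n` and `σ(p^k) = p^k`, and `n`-th roots are unique in the value group (the argument of
[FrdII] Thm. 1.2 (i) «`End_D(A_D)` acts trivially on `Φ(A_D)`», here for automorphisms of `K̄_v` over `K_v`).
[cite: MochizukiFrdII2008, Thm 1.2 (i) p.9] -/
theorem _root_.Literature.IUT.HodgeTheaters.GaloisValDatum.valuation_gal_eq (σ : d.Gal) (x : d.Ω) :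
    ValuativeRel.valuation d.Ω (σ x) = ValuativeRel.valuation d.Ω x := by
  rcases eq_or_ne x 0 with rfl | hx
  · rw [map_zero]
  obtain ⟨n, hn, k, hk⟩ := d.exists_valuation_pow_eq_zpow hx
  have hq : ValuativeRel.valuation d.Ω (x ^ n) = ValuativeRel.valuation d.Ω (((p : ℕ) : d.Ω) ^ k) := by
    rw [map_pow, hk, map_zpow₀]
  have hq' : ValuativeRel.valuation d.Ω (σ (x ^ n)) = ValuativeRel.valuation d.Ω (σ (((p : ℕ) : d.Ω) ^ k)) := by
    rw [← Valuation.veq_iff_eq, ValuativeRel.veq_def] at hq ⊢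
    exact ⟨(d.val_aut σ _ _).mpr hq.1, (d.val_aut σ _ _).mpr hq.2⟩
  rw [map_pow, map_zpow₀, map_natCast, map_pow, ← hq, map_pow] at hq'
  exact (pow_left_inj₀ zero_le zero_le hn.ne').mp hq'

/-- On units: `v(σ·x) = v(x)` for `x ∈ Ω^×`. [cite: MochizukiFrdII2008, Thm 1.2 (i) p.9] -/
theorem _root_.Literature.IUT.HodgeTheaters.GaloisValDatum.valuation_unitsMap_gal (σ : d.Gal) (x : d.Ωˣ) :
    ValuativeRel.valuation d.Ω ((Units.map (σ : d.Ω →* d.Ω) x : d.Ωˣ) : d.Ω) = ValuativeRel.valuation d.Ω (x : d.Ω) :=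
  d.valuation_gal_eq σ x

end Isometry

namespace ArithThetaTower

namespace ConstTower

variable {p : ℕ} [Fact p.Prime] {d : GaloisValDatum.{u} p} (K K' : ConstTower d)

/-! ## §2 Laws of every constant tower: `v` is restriction-invariant; base constants; uniqueness -/

/-- **The valuation is invariant under the restriction maps** (they read as Galois translates, and `Gal(Ω/K_v)` acts by
isometries) — the naturality input for `div₀` on constants. [cite: MochizukiEtTh2009, Def 3.3 (iii) p.299 (PDF p.73)] -/
theorem v_map {U V : (CosetCat d.Gal)ᵒᵖ} (f : U ⟶ V) (x : K.units.obj U) : K.v V ((K.units.map f).hom x) = K.v U x := by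
  obtain ⟨g, hg⟩ := Quotient.exists_rep (CosetCat.pt f.unop)
  rw [v_apply, v_apply, K.coe_toΩ_map f x hg.symm, d.valuation_gal_eq]

/-- Restriction maps preserve and reflect `O^▷`. [cite: MochizukiEtTh2009, Prop 3.4 (ii) p.300 (PDF p.74)] -/
theorem map_mem_integers_iff {U V : (CosetCat d.Gal)ᵒᵖ} (f : U ⟶ V) (x : K.units.obj U) :
    (K.units.map f).hom x ∈ K.integers V ↔ x ∈ K.integers U := by
  rw [mem_integers_iff, mem_integers_iff, v_map]

/-- Restriction maps preserve and reflect `O^×`. [cite: MochizukiEtTh2009, Prop 3.4 (ii) p.300 (PDF p.74)] -/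
theorem map_mem_intUnits_iff {U V : (CosetCat d.Gal)ᵒᵖ} (f : U ⟶ V) (x : K.units.obj U) :
    (K.units.map f).hom x ∈ K.intUnits V ↔ x ∈ K.intUnits U := by
  rw [mem_intUnits_iff, mem_intUnits_iff, v_map]

/-- **The base-field constants `K_v^×` live at every level**: `c ∈ K_v^×` read in `Ω` is (the reading of) a level-`U` constant,
for every `U`. [cite: MochizukiEtTh2009, Prop 3.4 (ii) p.300 (PDF p.74)] -/
theorem exists_toΩ_eq_algebraMap (U : (CosetCat d.Gal)ᵒᵖ) (c : d.kˣ) :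
    ∃ y : K.units.obj U, K.toΩ U y = Units.map (algebraMap d.k d.Ω : d.k →* d.Ω) c :=
  (K.exists_toΩ_eq_iff U _).mpr fun σ _ => σ.commutes (c : d.k)

/-- **The constants of the one-point covering `G/G` are EXACTLY `K_v^×`** (`Ω^{Gal(Ω/K_v)} = K_v`, infinite Galois theory).
[cite: MochizukiEtTh2009, Prop 3.4 (ii) p.300 (PDF p.74)] -/
theorem exists_toΩ_top_eq_iff (x : d.Ωˣ) :
    (∃ y : K.units.obj (op CosetCat.top), K.toΩ (op CosetCat.top) y = x) ↔ (x : d.Ω) ∈ Set.range (algebraMap d.k d.Ω) := by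
  rw [K.exists_toΩ_eq_iff, InfiniteGalois.mem_range_algebraMap_iff_fixed]
  exact ⟨fun h σ => h σ (Subgroup.mem_top σ), fun h σ _ => h σ⟩

/-- The level-`U` constant of `K'` with the same reading as a given level-`U` constant of `K` (choice-free up to the injective
reading). [cite: MochizukiEtTh2009, Def 3.3 (iii) p.299 (PDF p.73)] -/
theorem exists_unique_toΩ_eq (U : (CosetCat d.Gal)ᵒᵖ) (x : K.units.obj U) : ∃! y : K'.units.obj U, K'.toΩ U y = K.toΩ U x := by
  obtain ⟨y, hy⟩ := (K'.exists_toΩ_eq_iff U (K.toΩ U x)).mpr fun σ hσ => K.smul_toΩ U x hσ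
  exact ⟨y, hy, fun z hz => K'.toΩ_injective U (hz.trans hy.symm)⟩

/-- The level-`U` constant of `K'` with the same reading as `x` (transfer between presentations).
[cite: MochizukiEtTh2009, Def 3.3 (iii) p.299 (PDF p.73)] -/
def transferFun (U : (CosetCat d.Gal)ᵒᵖ) (x : K.units.obj U) : K'.units.obj U := Classical.choose (K.exists_unique_toΩ_eq K' U x)

/-- `transferFun` is reading-compatible. [cite: MochizukiEtTh2009, Def 3.3 (iii) p.299 (PDF p.73)] -/
theorem toΩ_transferFun (U : (CosetCat d.Gal)ᵒᵖ) (x : K.units.obj U) : K'.toΩ U (K.transferFun K' U x) = K.toΩ U x :=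
  (Classical.choose_spec (K.exists_unique_toΩ_eq K' U x)).1

/-- **Uniqueness of constant towers**: the reading-compatible multiplicative bijection `K.units(U) ≃* K'.units(U)` between the
level-`U` constants of any two constant towers of `d` (both read onto `(Ω^U)^×`). [cite: MochizukiEtTh2009, Def 3.3 (iii) p.299 (PDF p.73)] -/
def equivOf (U : (CosetCat d.Gal)ᵒᵖ) : (K.units.obj U : Type u) ≃* (K'.units.obj U : Type u) where
  toFun := K.transferFun K' U
  invFun := K'.transferFun K U
  left_inv x := K.toΩ_injective U (by rw [toΩ_transferFun, toΩ_transferFun])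
  right_inv y := K'.toΩ_injective U (by rw [toΩ_transferFun, toΩ_transferFun])
  map_mul' x y := K'.toΩ_injective U (by rw [map_mul, toΩ_transferFun, toΩ_transferFun, toΩ_transferFun, map_mul])

/-- `equivOf` is reading-compatible. [cite: MochizukiEtTh2009, Def 3.3 (iii) p.299 (PDF p.73)] -/
theorem toΩ_equivOf (U : (CosetCat d.Gal)ᵒᵖ) (x : K.units.obj U) : K'.toΩ U (K.equivOf K' U x) = K.toΩ U x :=
  K.toΩ_transferFun K' U x

/-- `equivOf` is natural: it commutes with the restriction maps. [cite: MochizukiEtTh2009, Def 3.3 (iii) p.299 (PDF p.73)] -/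
theorem equivOf_map {U V : (CosetCat d.Gal)ᵒᵖ} (f : U ⟶ V) (x : K.units.obj U) :
    K.equivOf K' V ((K.units.map f).hom x) = (K'.units.map f).hom (K.equivOf K' U x) := by
  obtain ⟨g, hg⟩ := Quotient.exists_rep (CosetCat.pt f.unop)
  apply K'.toΩ_injective V
  apply Units.ext
  rw [toΩ_equivOf, K.coe_toΩ_map f x hg.symm, K'.coe_toΩ_map f _ hg.symm, toΩ_equivOf]

/-- `equivOf` preserves the valuation. [cite: MochizukiEtTh2009, Def 3.3 (iii) p.299 (PDF p.73)] -/
theorem v_equivOf (U : (CosetCat d.Gal)ᵒᵖ) (x : K.units.obj U) : K'.v U (K.equivOf K' U x) = K.v U x := by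
  rw [v_apply, v_apply, toΩ_equivOf]

/-! ## §3 THE genuine constant tower `U ↦ ((Ω^U)^×, v)` -/

variable (d)

/-- The reading `(Ω^U)^× → Ω^×` (units of the inclusion `Ω^U ⊆ Ω`). [cite: MochizukiEtTh2009, Def 3.3 (iii) p.299 (PDF p.73)] -/
def readFixed (U : (CosetCat d.Gal)ᵒᵖ) : (↥(d.fixedFld U.unop))ˣ →* d.Ωˣ :=
  Units.map ((d.fixedFld U.unop).val : ↥(d.fixedFld U.unop) →* d.Ω)

/-- The reading in `Ω` is the underlying element. [cite: MochizukiEtTh2009, Def 3.3 (iii) p.299 (PDF p.73)] -/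
@[simp] theorem coe_readFixed (U : (CosetCat d.Gal)ᵒᵖ) (x : (↥(d.fixedFld U.unop))ˣ) :
    ((readFixed d U x : d.Ωˣ) : d.Ω) = ((x : d.fixedFld U.unop) : d.Ω) := rfl

/-- **THE GENUINE CONSTANT TOWER of `d`**: `units := PadicFrd.bZeroOn d.fieldFunctor` — [FrdII] Ex. 1.1's `B₀ = Spec K ↦ K^×`
restricted along the base functor `G/U ↦ Spec Ω^U` of the real `C_v`/`C⊢_v` —, i.e. `U ↦ (Ω^U)^×` with restriction maps
`Units.map (x ↦ g·x)`, read in `Ω^×` by the inclusions `Ω^U ⊆ Ω`; the image is `(Ω^U)^×` by definition of the fixed field and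
the restriction maps read as Galois translates by `fixedHom_apply_coe`. [cite: MochizukiEtTh2009, Def 3.3 (iii) p.299 (PDF p.73)] -/
def ofGaloisValDatum : ConstTower d where
  units := PadicFrd.bZeroOn d.fieldFunctor
  toΩ U := readFixed d U
  toΩ_injective U := by
    intro x y h
    exact Units.ext (Subtype.ext (congrArg (fun z : d.Ωˣ => (z : d.Ω)) h))
  exists_toΩ_eq_iff U x := by
    constructor
    · rintro ⟨y, rfl⟩ σ hσ
      exact (IntermediateField.mem_fixedField_iff _ _).mp ((show (↥(d.fixedFld U.unop))ˣ from y) : d.fixedFld U.unop).2 σ hσ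
    · intro hx
      have hmem : (x : d.Ω) ∈ d.fixedFld U.unop := (IntermediateField.mem_fixedField_iff _ _).mpr hx
      have hmem' : ((x⁻¹ : d.Ωˣ) : d.Ω) ∈ d.fixedFld U.unop := by
        rw [Units.val_inv_eq_inv_val]
        exact inv_mem hmem
      exact ⟨⟨⟨(x : d.Ω), hmem⟩, ⟨((x⁻¹ : d.Ωˣ) : d.Ω), hmem'⟩, Subtype.ext x.mul_inv, Subtype.ext x.inv_mul⟩, Units.ext rfl⟩
  toΩ_map {U V} f g hg x := by
    obtain ⟨x, rfl⟩ : ∃ x' : (↥(d.fixedFld U.unop))ˣ, x' = x := ⟨x, rfl⟩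
    change ((d.fixedHom f.unop (x : d.fixedFld U.unop) : d.fixedFld V.unop) : d.Ω) = g ((x : d.fixedFld U.unop) : d.Ω)
    exact d.fixedHom_apply_coe f.unop g hg _

/-- The constants functor IS L1's `B₀|_{D⊢_v}` over the genuine base functor (by definition).
[cite: MochizukiFrdII2008, Ex 1.1 (i) p.7] -/
theorem ofGaloisValDatum_units : (ofGaloisValDatum d).units = PadicFrd.bZeroOn d.fieldFunctor := rfl

/-- The level-`U` constants ARE `(Ω^U)^×` (definitionally). [cite: MochizukiEtTh2009, Prop 3.4 (ii) p.300 (PDF p.74)] -/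
theorem ofGaloisValDatum_units_obj (U : (CosetCat d.Gal)ᵒᵖ) :
    ((ofGaloisValDatum d).units.obj U : Type u) = (↥(d.fixedFld U.unop))ˣ := rfl

/-- The restriction maps ARE `Units.map` of L5-t2's `fixedHom` (`x ↦ g·x`) (definitionally).
[cite: MochizukiEtTh2009, Def 3.3 (iii) p.299 (PDF p.73)] -/
theorem ofGaloisValDatum_units_map {U V : (CosetCat d.Gal)ᵒᵖ} (f : U ⟶ V) :
    ((ofGaloisValDatum d).units.map f).hom = Units.map (d.fixedHom f.unop : ↥(d.fixedFld U.unop) →* ↥(d.fixedFld V.unop)) := rfl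

/-- The reading is the inclusion `Ω^U ⊆ Ω` on units (definitionally). [cite: MochizukiEtTh2009, Def 3.3 (iii) p.299 (PDF p.73)] -/
theorem ofGaloisValDatum_toΩ (U : (CosetCat d.Gal)ᵒᵖ) : (ofGaloisValDatum d).toΩ U = readFixed d U := rfl

/-- `v ≤ 1` at the genuine tower is «`≤ᵥ 1`» for the restricted valuative relation `valOn` of `Ω^U` — the one the genuine `p_v`-adic
Frobenioids `C_v`, `C⊢_v` use (`O^▷_{Ω^U} = PadicFrd.intNonzero`). [cite: MochizukiFrdII2008, Ex 1.1 (i) p.7] -/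
theorem v_le_one_iff_valOn (U : (CosetCat d.Gal)ᵒᵖ) (x : (↥(d.fixedFld U.unop))ˣ) :
    (ofGaloisValDatum d).v U x ≤ 1 ↔ @ValuativeRel.vle _ _ (d.valOn (d.fixedFld U.unop)) (x : d.fixedFld U.unop) 1 := by
  rw [v_le_one_iff, d.valOn_iff, OneMemClass.coe_one]
  rfl

/-- `v = 1` at the genuine tower is «`=ᵥ 1`» for `valOn` (`O^×_{Ω^U}`). [cite: MochizukiFrdII2008, Ex 1.1 (i) p.7] -/
theorem v_eq_one_iff_valOn (U : (CosetCat d.Gal)ᵒᵖ) (x : (↥(d.fixedFld U.unop))ˣ) :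
    (ofGaloisValDatum d).v U x = 1 ↔ @ValuativeRel.veq _ _ (d.valOn (d.fixedFld U.unop)) (x : d.fixedFld U.unop) 1 := by
  rw [v_eq_one_iff, ValuativeRel.veq_def, @ValuativeRel.veq_def _ _ (d.valOn _), d.valOn_iff, d.valOn_iff, OneMemClass.coe_one]
  rfl

/-! ### The base-field constants `K_v^× → (Ω^U)^×` -/

/-- **The base constants at level `U`**: `K_v^× → (Ω^U)^×`, `c ↦ c` (units of the structure map `K_v → Ω^U`, L5-t2's `relEmb`).
[cite: MochizukiEtTh2009, Prop 3.4 (ii) p.300 (PDF p.74)] -/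
def const (U : (CosetCat d.Gal)ᵒᵖ) : d.kˣ →* ((ofGaloisValDatum d).units.obj U : Type u) :=
  (Units.map (algebraMap d.k (d.fixedFld U.unop) : d.k →* ↥(d.fixedFld U.unop)) : d.kˣ →* (↥(d.fixedFld U.unop))ˣ)

/-- The base constants read in `Ω` as `K_v ⊆ Ω`. [cite: MochizukiEtTh2009, Prop 3.4 (ii) p.300 (PDF p.74)] -/
theorem coe_toΩ_const (U : (CosetCat d.Gal)ᵒᵖ) (c : d.kˣ) :
    (((ofGaloisValDatum d).toΩ U (const d U c) : d.Ωˣ) : d.Ω) = algebraMap d.k d.Ω c := rfl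

/-- **The base constants are compatible with every restriction map** (`g` fixes `K_v`).
[cite: MochizukiEtTh2009, Prop 3.4 (ii) p.300 (PDF p.74)] -/
theorem map_const {U V : (CosetCat d.Gal)ᵒᵖ} (f : U ⟶ V) (c : d.kˣ) :
    ((ofGaloisValDatum d).units.map f).hom (const d U c) = const d V c := by
  obtain ⟨g, hg⟩ := Quotient.exists_rep (CosetCat.pt f.unop)
  apply (ofGaloisValDatum d).toΩ_injective V
  apply Units.ext
  rw [(ofGaloisValDatum d).coe_toΩ_map f _ hg.symm, coe_toΩ_const, coe_toΩ_const]
  exact g.commutes (c : d.k)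

/-- The valuation of a base constant is that of `K_v` read in `Ω`: `v(c) ≤ 1 ↔ c ≤ᵥ 1` in `K_v` (the relation of `Ω` extends
that of `K_v`). [cite: MochizukiFrdII2008, Ex 1.1 (i) p.7] -/
theorem v_const_le_one_iff (U : (CosetCat d.Gal)ᵒᵖ) (c : d.kˣ) : (ofGaloisValDatum d).v U (const d U c) ≤ 1 ↔ (c : d.k) ≤ᵥ 1 := by
  rw [v_le_one_iff, coe_toΩ_const, ← (algebraMap d.k d.Ω).map_one, ValuativeExtension.vle_iff_vle]

/-- `v(c) = 1 ↔ c =ᵥ 1` in `K_v`: **`O^×_{K_v}` goes to `O^×(Ω^U)`** (the constants `O^×_{K_v} → O^×(T^÷_{Ÿ_v})` of [IUTchI]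
Ex. 3.2 (ii)). [cite: MochizukiEtTh2009, §5 p.330 (PDF p.104)] -/
theorem v_const_eq_one_iff (U : (CosetCat d.Gal)ᵒᵖ) (c : d.kˣ) : (ofGaloisValDatum d).v U (const d U c) = 1 ↔ (c : d.k) =ᵥ 1 := by
  rw [v_eq_one_iff, coe_toΩ_const, ValuativeRel.veq_def, ValuativeRel.veq_def, ← (algebraMap d.k d.Ω).map_one,
    ValuativeExtension.vle_iff_vle, ValuativeExtension.vle_iff_vle]

/-- `O^▷_{K_v}` goes to `O^▷(Ω^U)`. [cite: MochizukiEtTh2009, Prop 3.4 (ii) p.300 (PDF p.74)] -/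
theorem const_mem_integers {U : (CosetCat d.Gal)ᵒᵖ} {c : d.kˣ} (hc : (c : d.k) ≤ᵥ 1) : const d U c ∈ (ofGaloisValDatum d).integers U :=
  (v_const_le_one_iff d U c).mpr hc

/-- `O^×_{K_v}` goes to `O^×(Ω^U)`. [cite: MochizukiEtTh2009, §5 p.330 (PDF p.104)] -/
theorem const_mem_intUnits {U : (CosetCat d.Gal)ᵒᵖ} {c : d.kˣ} (hc : (c : d.k) =ᵥ 1) : const d U c ∈ (ofGaloisValDatum d).intUnits U :=
  (v_const_eq_one_iff d U c).mpr hc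

/-! ### Non-vacuity -/

/-- **NON-VACUITY**: the genuine constant tower of abc-iut-L5-t2's hypothesis-free datum `K_v = ℚ_p`, `Ω = ℚ̄_p`.
[cite: MochizukiFrdII2008, Ex 1.1 (i) p.7] -/
theorem nonempty_ofPadic (q : ℕ) [Fact q.Prime] : Nonempty (ConstTower (GaloisValDatum.ofPadic q)) := ⟨ofGaloisValDatum _⟩

end ConstTower

/-! ## §4 Names of record (abc-iut-L5-lead RULINGS #337 (2)(b); `plan/L5/GAP-A-SIGNATURES.md` §1 S1) -/

variable {p : ℕ} [Fact p.Prime] (d : GaloisValDatum.{u} p)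

/-- **`constTower d` — S1 of GAP A, the name of record**: the genuine constants `U ↦ (Ω^U)^×` as a monoid on
`D⊢_v = CosetCat Gal(Ω/K_v)`, `:= (ConstTower.ofGaloisValDatum d).units = PadicFrd.bZeroOn d.fieldFunctor`; consumed by GAP A's D2
through `T.proj.op ⋙ constTower d` (constants go through `T.proj`, not through `rebase`). [cite: MochizukiEtTh2009, Def 3.3 (iii) p.299 (PDF p.73)] -/
abbrev constTower : (CosetCat d.Gal)ᵒᵖ ⥤ CommMonCat.{u} := (ConstTower.ofGaloisValDatum d).units

/-- `constTower d` IS L1's `B₀|_{D⊢_v} = bZeroOn d.fieldFunctor` (definitionally). [cite: MochizukiFrdII2008, Ex 1.1 (i) p.7] -/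
theorem constTower_eq_bZeroOn : constTower d = PadicFrd.bZeroOn d.fieldFunctor := rfl

/-- **Merge lemma for D2** (`B₀` constants «through `T.proj ⋙ d.fieldFunctor` then `PadicFrd.bZero`»): pulling `constTower d` back
along ANY functor `F` into `D⊢_v` is L1's `bZeroOn (F ⋙ d.fieldFunctor)` ON THE NOSE. [cite: MochizukiFrdII2008, Ex 1.1 (i) p.7] -/
theorem op_comp_constTower {C : Type u} [Category.{v} C] (F : C ⥤ CosetCat d.Gal) :
    F.op ⋙ constTower d = PadicFrd.bZeroOn (F ⋙ d.fieldFunctor) := rfl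

/-- **`constOrd d` — the name of record for the valuation of the constants** (typer's call per GAP-A-SIGNATURES §6: target = the
value group of `Ω`, one for all levels): `constOrd d U := (ConstTower.ofGaloisValDatum d).v U`. [cite: MochizukiFrdII2008, Ex 1.1 (i) p.7] -/
abbrev constOrd (U : (CosetCat d.Gal)ᵒᵖ) : ((constTower d).obj U : Type u) →* ValuativeRel.ValueGroupWithZero d.Ω :=
  (ConstTower.ofGaloisValDatum d).v U

/-- **`constOrd_natural`** (name of record): the valuation of constants is INVARIANT under every pull-back map of `constTower d`
(with one value group for all levels no ramification index appears; it reappears only when `constOrd` is re-normalised level by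
level, e.g. through L1's `OrdInt (Ω^U) ≅ ℤ_{≥0}`). [cite: MochizukiEtTh2009, Def 3.3 (iii) p.299 (PDF p.73)] -/
theorem constOrd_natural {U V : (CosetCat d.Gal)ᵒᵖ} (f : U ⟶ V) (x : (constTower d).obj U) :
    constOrd d V (((constTower d).map f).hom x) = constOrd d U x :=
  (ConstTower.ofGaloisValDatum d).v_map f x

/-- `constOrd` unfolded: the valuation of `Ω` at the underlying element. [cite: MochizukiFrdII2008, Ex 1.1 (i) p.7] -/
theorem constOrd_apply (U : (CosetCat d.Gal)ᵒᵖ) (x : (↥(d.fixedFld U.unop))ˣ) :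
    constOrd d U x = ValuativeRel.valuation d.Ω ((x : d.fixedFld U.unop) : d.Ω) := rfl

end ArithThetaTower

end Literature.AnabelianGeometry.EtaleTheta

end
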